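import Summits.QuantumFields.YangMills.Theorems.UnitScaleTiltProp7MassiveConjugateResolvent
import HarnessLib

/-!
# Route `UnitScaleTilt`, crux K1 «MinimiserStabilityRegPr» (stmt-QuantumFields-19200), EX row `hGF[Lift]` ∕ `h349[Lift]` (curved member) — **LOD LINE BRICK (L5′-member), FILE B2a′
# (routeR-w2 g12, sequel of ✓`Prop7MassiveConjugateResolvent`): THE CONJUGATED MASSIVE PROPAGATOR IS CLOSE TO THE PROPAGATOR, `‖W∘G_a∘W⁻¹ − G_a‖ ≤ δ` K-uniformly.**

Cell `ym3-torus` (HUMAN RULING D-0037, YM ladder rung R3 — NOT d = 4, NOT infinite volume, NOT a mass gap, NOT Clay).  Width seat `ym-routeR-w2` gen 12 (D-0154 (3c); chair ★p1 g24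
«road (L5′-G)», 23:28:16Z «GO»; ★★OWNER RULINGS №33∕№35).  THEOREMS ONLY (0 `def`, 0 `sorry`); px5 g11's member letters VERBATIM; `--supports stmt-QuantumFields-19200 --as helper`,
count-neutral.  HONEST LABEL (№33 (6)): curved γ-row ∕ (3.49) supplier line (LOD localisation), the coarse-Gram Agmon step (G); nothing of (3.49), Thm 3.1∕3.3, `h349`, `hGF`, (L5″),
EX ∕ 19200 is proved here; no summit statement is proved by this seat.  K-UNIFORMITY PIN (★p1 g24 22:52Z ∕ 23:54:10Z, px16 g11's question): `C_P² = max 2 (16c₀(L^{K−n})³∕(a c₁))` is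
K-free AT THE PINNED WEIGHTS `c₁ = c₀·L^{3(K−n)}` (then `C_P² = max 2 (16∕a)`) with `a` the FIXED mass parameter of the massive operator; every `δ`, `κ₁`, `ε` below is K-, L-, volume-free in that sense.

THE MATHEMATICS.  With `ũ := W g̃` where `A g̃ = W⁻¹w₀` (`W = w·`, `A = Δ_{U₀} + a·T∘ι∘Q″`, `G = A⁻¹`), the error `e := ũ − G w₀` solves `A e = −(W(Ag̃) − A(Wg̃))`; testing with `e`:
`S := re⟪e, Ae⟫ = ‖De‖² + a‖ιQ″e‖²` (px5 ✓`re_inner_massive_eq`), `‖e‖ ≤ C_P√S` (✓`coercive_massive`), and by the form commutator bound of the prequel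
`S ≤ κ₁·X(e)·X(ũ) ≤ κ₁(2 + C_P)√S·X(ũ)`; px5's ✓`agmon_rows_of_massive_eq` gives `X(ũ) ≤ (8C_P + 8C_P²)‖w₀‖`.  Hence ★★★ `‖W·G(W⁻¹w₀) − G w₀‖ ≤ C_P(2+C_P)·κ₁·(8C_P + 8C_P²)·‖w₀‖`,
`κ₁ = e₁ + e₁² + √aC_Tρ′ + aC_T²ρ′²`, `e₁ = √3η⁻¹ρ` — every constant K-, L-, volume-free.  This is the `hplus`∕`hminus` input of ✓`Prop7GramConjAccretive.re_conj_gram_ge` at the member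
(FILE B2b adds the coarse-side row `‖WTW_c⁻¹ − T‖ ≤ C_Tρ′` and Parseval).

WHAT IS PROVED (ns `Summit.QuantumFields.YangMills.Theorems.Prop7MassiveConjugateResolvent`, continued): ★★★ `norm_weight_massive_inverse_sub_le` (`maxHeartbeats 400000`, decl-local).

References: S. Agmon (1982) Ch. 1 [folklore]; T. Bałaban, CMP **99** (1985) 389–434 [Balaban1985BackgroundPropagators] ((3.24) p.394, Thm 3.1 (3.46) p.398, (3.100)–(3.105) pp.413–414);
CMP **116** (1988) 1–22 [Balaban1988RG2Cluster] ((2.7) p.13).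
-/

set_option autoImplicit false

noncomputable section

open scoped BigOperators Matrix.Norms.L2Operator InnerProductSpace ComplexConjugate

namespace Summit.QuantumFields.YangMills.Theorems.Prop7MassiveConjugateResolvent

open Literature.MathematicalPhysics.QuantumFieldTheory.Balaban1983to89
open Finset
open T4Continuum BlockAveraging
open BlockAveraging (Idx)
open B7Prop1Explicit (U1 disp)
open B5Eq118OneStroke (iterBlockOf iterBlock)
open B10Eq27TorusAxialLog (holT transl)
open B7TransferAnalyticMean (meanCLM)
open B9Eq311L2Pairing (WL2)
open B11Eq103H1Complex (SiteL2K BondL2K)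
open B9Eq39Adjoint (R)
open Summit.QuantumFields.YangMills.Theorems.Prop8Chart (emlIterU)
open Literature.MathematicalPhysics.QuantumFieldTheory.Balaban1983to89.T3ContinuumYM3Torus
open T3SectALandauChart (eta eta_pos bgUnits)
open T3PrintedRegularMinimiser (RegPr)
open T3PrintedRegularOrbits (sites_eq)
open T3LevelShift (siteShift)
open Summit.QuantumFields.YangMills.Theorems.Prop7SectET3Transport (periodsT3)
open Summit.QuantumFields.YangMills.Theorems.Prop7SectET3HilbertLetters (W₂ toL2 toL2S DL2 DstarL2 covLapSite adjoint_DL2 inner_toL2)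
open Summit.QuantumFields.YangMills.Theorems.Prop7SectET3RealCoordSums (inner_toL2S)
open Summit.QuantumFields.YangMills.Theorems.Prop7LaplaceAFlatLetters (norm_sq_toL2 norm_sq_toL2S)

variable (F : T3Family) {n K : ℕ} (h : n ≤ K) {c₀ c₁ : ℝ} [Fact (0 < c₀)] [Fact (0 < c₁)]
  {ε₀ : ℝ} (hε₀ : 0 < ε₀) (hε7 : 10 ^ 7 * (F.L : ℝ) ^ 3 * ε₀ ≤ 1)
  (U₀ : GaugeField (F.P K) 0 (Matrix.specialUnitaryGroup (Fin 2) ℂ)) (hreg : RegPr F n K ε₀ U₀)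
  (Q'' : SiteL2K ℂ 3 (periodsT3 F K) c₀ W₂ →ₗ[ℂ] (Site (F.P K) (K - n) → Matrix (Fin 2) (Fin 2) ℂ))
  (hseq : ∀ lam : Site (F.P K) 0 → Matrix (Fin 2) (Fin 2) ℂ, ∃ ns : (j : ℕ) → Site (F.P K) j → Matrix (Fin 2) (Fin 2) ℂ, ns 0 = lam ∧
      (∀ (j : ℕ) (y : Site (F.P K) (j + 1)), ns (j + 1) y = ns j (emb y) - meanCLM (Idx (F.P K)) (Matrix (Fin 2) (Fin 2) ℂ) fun i : Idx (F.P K) =>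
        ns j (emb y) - ((holT (emlIterU j (bgUnits F K U₀)) (emb y) (stairWord i.2.1 (off i.1)) : (Matrix (Fin 2) (Fin 2) ℂ)ˣ) : Matrix (Fin 2) (Fin 2) ℂ) *
          ns j (transl (emb y) (disp (stairWord i.2.1 (off i.1)))) * (((holT (emlIterU j (bgUnits F K U₀)) (emb y) (stairWord i.2.1 (off i.1)))⁻¹ : (Matrix (Fin 2) (Fin 2) ℂ)ˣ) : Matrix (Fin 2) (Fin 2) ℂ)) ∧
      ns (K - n) = Q'' (toL2S F K c₀ lam))
  (ι : (Site (F.P K) (K - n) → Matrix (Fin 2) (Fin 2) ℂ) →ₗ[ℂ] SiteL2K ℂ 3 (periodsT3 F n) c₁ W₂)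
  (hι : ∀ c, ι c = toL2S F n c₁ (fun z => c (siteShift (sites_eq F n K h) z)))
  (T : SiteL2K ℂ 3 (periodsT3 F n) c₁ W₂ →ₗ[ℂ] SiteL2K ℂ 3 (periodsT3 F K) c₀ W₂)
  (hT : ∀ (l : SiteL2K ℂ 3 (periodsT3 F K) c₀ W₂) (f : SiteL2K ℂ 3 (periodsT3 F n) c₁ W₂), ⟪ι (Q'' l), f⟫_ℂ = ⟪l, T f⟫_ℂ)
  {a : ℝ} (ha : 0 < a)
  (G : SiteL2K ℂ 3 (periodsT3 F K) c₀ W₂ →ₗ[ℂ] SiteL2K ℂ 3 (periodsT3 F K) c₀ W₂)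
  (hAG : ∀ f, covLapSite F n K c₀ U₀ (G f) + (a : ℂ) • T (ι (Q'' (G f))) = f)
  (hGA : ∀ u, G (covLapSite F n K c₀ U₀ u + (a : ℂ) • T (ι (Q'' u))) = u)

/-! ## §3 The conjugated resolvent bound -/

section Resolvent

open Summit.QuantumFields.YangMills.Theorems.Prop7MassivePropagatorCoercive (re_inner_massive_eq coercive_massive)
open Summit.QuantumFields.YangMills.Theorems.Prop7MassivePropagatorAgmon (agmon_rows_of_massive_eq)

include hε₀ hε7 hreg hseq hι hT ha hAG in
set_option maxHeartbeats 400000 in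
/-- ★★★ **THE CONJUGATED MASSIVE PROPAGATOR IS CLOSE TO THE PROPAGATOR**: for a positive fine weight `w` and a positive coarse weight `w_c` in px5's Agmon window (bond ratios `≤ ρ`, in-block
ratios `≤ ρ′`, `3η⁻²ρ² + a(25∕8)κρ′² ≤ δ₁²`, `C_Pδ₁ ≤ 1∕10`) and `‖ι(Q″v)‖ ≤ C_T‖v‖`: with `g` the solution of `A(toL2S g) = toL2S(w⁻¹·w₀)`,
`‖toL2S(w·g) − G(toL2S w₀)‖ ≤ C_P(2 + C_P)·κ₁·(8C_P + 8C_P²)·‖toL2S w₀‖`, `κ₁ = e₁ + e₁² + √aC_Tρ′ + aC_T²ρ′²`, `e₁ = √3η⁻¹ρ`, `C_P = √(max 2 (16c₀(L^{K−n})³∕(ac₁)))` — i.e.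
`‖W∘G∘W⁻¹ − G‖ ≤ δ` with `δ` K-, L-, volume-free; the `hplus`∕`hminus` input of ✓`Prop7GramConjAccretive.re_conj_gram_ge` (FILE B2b adds the coarse side and Parseval).
PROOF: `e := W g̃ − G w₀` solves `A e = −(W(Ag̃) − A(Wg̃))`; test with `e` (§2 + px5 ✓`re_inner_massive_eq`∕✓`coercive_massive`), then ✓`agmon_rows_of_massive_eq` sizes `X(Wg̃)`.
[cite: Balaban1985BackgroundPropagators, Thm 3.1 (3.46) p.398, (3.100)–(3.105) pp.413–414; Balaban1988RG2Cluster, (2.7) p.13] -/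
theorem norm_weight_massive_inverse_sub_le (w : Site (F.P K) 0 → ℝ) (hw : ∀ x, 0 < w x) (wc : Site (F.P K) (K - n) → ℝ) (hwc : ∀ y, 0 < wc y)
    {ρ ρ' : ℝ} (hρ : 0 ≤ ρ) (hρ' : 0 ≤ ρ')
    (hwρ : ∀ b : PBond (F.P K) 0, |w b.tgt / w b.src - 1| ≤ ρ ∧ |w b.src / w b.tgt - 1| ≤ ρ)
    (hwρ' : ∀ x : Site (F.P K) 0, |w x / wc (iterBlockOf (K - n) x) - 1| ≤ ρ' ∧ |wc (iterBlockOf (K - n) x) / w x - 1| ≤ ρ')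
    {δ₁ : ℝ} (hδ₁ : 0 ≤ δ₁)
    (hδ : 3 * ((eta F n K)⁻¹) ^ 2 * ρ ^ 2 + a * ((25 / 8) * (c₁ * ((((F.P K).L : ℝ) ^ (F.P K).d) ^ (K - n))⁻¹ / c₀)) * ρ' ^ 2 ≤ δ₁ ^ 2)
    (hwin : Real.sqrt (max 2 (16 * c₀ * ((F.L : ℝ) ^ (K - n)) ^ 3 / (a * c₁))) * δ₁ ≤ 1 / 10)
    {CT : ℝ} (hCT : 0 ≤ CT) (hCTb : ∀ v : Site (F.P K) 0 → Matrix (Fin 2) (Fin 2) ℂ, ‖ι (Q'' (toL2S F K c₀ v))‖ ≤ CT * ‖toL2S F K c₀ v‖)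
    (w₀ : Site (F.P K) 0 → Matrix (Fin 2) (Fin 2) ℂ) :
    ‖toL2S F K c₀ (fun x => w x • (toL2S F K c₀).symm (G (toL2S F K c₀ (fun x => (w x)⁻¹ • w₀ x))) x) - G (toL2S F K c₀ w₀)‖
      ≤ Real.sqrt (max 2 (16 * c₀ * ((F.L : ℝ) ^ (K - n)) ^ 3 / (a * c₁))) * (2 + Real.sqrt (max 2 (16 * c₀ * ((F.L : ℝ) ^ (K - n)) ^ 3 / (a * c₁))))
        * (Real.sqrt 3 * (eta F n K)⁻¹ * ρ + (Real.sqrt 3 * (eta F n K)⁻¹ * ρ) ^ 2 + Real.sqrt a * CT * ρ' + a * CT ^ 2 * ρ' ^ 2)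
        * ((8 * Real.sqrt (max 2 (16 * c₀ * ((F.L : ℝ) ^ (K - n)) ^ 3 / (a * c₁))) + 8 * Real.sqrt (max 2 (16 * c₀ * ((F.L : ℝ) ^ (K - n)) ^ 3 / (a * c₁))) ^ 2)
            * ‖toL2S F K c₀ w₀‖) := by
  have hη : 0 < eta F n K := eta_pos F n K
  have hw0 : ∀ x, w x ≠ 0 := fun x => (hw x).ne'
  set Mx : ℝ := max 2 (16 * c₀ * ((F.L : ℝ) ^ (K - n)) ^ 3 / (a * c₁)) with hMx
  have hMx0 : 0 < Mx := lt_of_lt_of_le (by norm_num) (le_max_left _ _)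
  set CP : ℝ := Real.sqrt Mx with hCP
  have hCP0 : 0 ≤ CP := Real.sqrt_nonneg _
  have hCP2 : CP ^ 2 = Mx := Real.sq_sqrt hMx0.le
  set κ₁ : ℝ := Real.sqrt 3 * (eta F n K)⁻¹ * ρ + (Real.sqrt 3 * (eta F n K)⁻¹ * ρ) ^ 2 + Real.sqrt a * CT * ρ' + a * CT ^ 2 * ρ' ^ 2 with hκ₁
  have hκ₁0 : 0 ≤ κ₁ := by positivity
  -- the inverse weight
  set wi : Site (F.P K) 0 → ℝ := fun x => (w x)⁻¹ with hwi_def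
  have hwi : ∀ x, wi x * w x = 1 := fun x => inv_mul_cancel₀ (hw0 x)
  have hwiρ : ∀ b : PBond (F.P K) 0, |wi b.tgt / wi b.src - 1| ≤ ρ := fun b => by
    have : wi b.tgt / wi b.src = w b.src / w b.tgt := by rw [hwi_def]; field_simp
    rw [this]; exact (hwρ b).2
  have hr : ∀ x, |(wc (iterBlockOf (K - n) x))⁻¹ * w x - 1| ≤ ρ' := fun x => by rw [inv_mul_eq_div]; exact (hwρ' x).1
  have hr' : ∀ x, |wc (iterBlockOf (K - n) x) * wi x - 1| ≤ ρ' := fun x => by rw [hwi_def]; simp only; rw [← div_eq_mul_inv]; exact (hwρ' x).2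
  -- the solution `g`, its weighted version `ũ`, the error `e`
  set g : Site (F.P K) 0 → Matrix (Fin 2) (Fin 2) ℂ := (toL2S F K c₀).symm (G (toL2S F K c₀ (fun x => (w x)⁻¹ • w₀ x))) with hg_def
  have hg : toL2S F K c₀ g = G (toL2S F K c₀ (fun x => (w x)⁻¹ • w₀ x)) := (toL2S F K c₀).apply_symm_apply _
  have hAu : covLapSite F n K c₀ U₀ (toL2S F K c₀ g) + (a : ℂ) • T (ι (Q'' (toL2S F K c₀ g))) = toL2S F K c₀ (fun x => (w x)⁻¹ • w₀ x) := by rw [hg, hAG]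
  set ut := toL2S F K c₀ (fun x => w x • g x) with hut
  set w0t := toL2S F K c₀ w₀ with hw0t
  -- the source as the weighted image of `A g̃`
  have hsrc : toL2S F K c₀ (fun x => w x • (toL2S F K c₀).symm (covLapSite F n K c₀ U₀ (toL2S F K c₀ g) + (a : ℂ) • T (ι (Q'' (toL2S F K c₀ g)))) x) = w0t := by
    rw [hAu, LinearEquiv.symm_apply_apply, hw0t]
    congr 1; funext x
    rw [smul_smul, mul_inv_cancel₀ (hw0 x), one_smul]
  set e := ut - G w0t with he
  -- the error equation
  have hAe : covLapSite F n K c₀ U₀ e + (a : ℂ) • T (ι (Q'' e))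
      = -(toL2S F K c₀ (fun x => w x • (toL2S F K c₀).symm (covLapSite F n K c₀ U₀ (toL2S F K c₀ g) + (a : ℂ) • T (ι (Q'' (toL2S F K c₀ g)))) x)
          - (covLapSite F n K c₀ U₀ ut + (a : ℂ) • T (ι (Q'' ut)))) := by
    have h1 : covLapSite F n K c₀ U₀ e + (a : ℂ) • T (ι (Q'' e))
        = (covLapSite F n K c₀ U₀ ut + (a : ℂ) • T (ι (Q'' ut))) - (covLapSite F n K c₀ U₀ (G w0t) + (a : ℂ) • T (ι (Q'' (G w0t)))) := by
      rw [he, map_sub, map_sub, map_sub, map_sub, smul_sub]; abel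
    rw [h1, hAG, hsrc]; abel
  -- the energy of the error
  set S : ℝ := RCLike.re ⟪e, covLapSite F n K c₀ U₀ e + (a : ℂ) • T (ι (Q'' e))⟫_ℂ with hS
  have hSeq : S = ‖DL2 F n K c₀ U₀ e‖ ^ 2 + a * ‖ι (Q'' e)‖ ^ 2 := re_inner_massive_eq F U₀ Q'' ι T hT (a := a) e
  have hS0 : 0 ≤ S := by rw [hSeq]; positivity
  have hDe : ‖DL2 F n K c₀ U₀ e‖ ≤ Real.sqrt S := by
    refine Real.le_sqrt_of_sq_le ?_; rw [hSeq]; nlinarith [sq_nonneg ‖ι (Q'' e)‖, ha.le]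
  have hQe : Real.sqrt a * ‖ι (Q'' e)‖ ≤ Real.sqrt S := by
    refine Real.le_sqrt_of_sq_le ?_; rw [hSeq, mul_pow, Real.sq_sqrt ha.le]; nlinarith [sq_nonneg ‖DL2 F n K c₀ U₀ e‖]
  have hne : ‖e‖ ≤ CP * Real.sqrt S := by
    have hco := coercive_massive F h hε₀ hε7 U₀ hreg Q'' hseq ι hι ha e
    rw [← hMx, ← hSeq] at hco
    have h1 : ‖e‖ ^ 2 ≤ (CP * Real.sqrt S) ^ 2 := by rw [mul_pow, hCP2, Real.sq_sqrt hS0]; exact hco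
    exact (pow_le_pow_iff_left₀ (norm_nonneg _) (by positivity) two_ne_zero).1 h1
  -- test the error equation with the error: `S = −re⟪e, Y⟫ ≤ κ₁·X(e)·X(ũ)`
  have hez : e = toL2S F K c₀ ((toL2S F K c₀).symm e) := ((toL2S F K c₀).apply_symm_apply e).symm
  have hcomm := abs_re_inner_weight_comm_le F h U₀ Q'' hseq ι hι T hT ha w wi hw hwi hρ (fun b => (hwρ b).1) hwiρ wc hwc hρ' hr hr' hCT hCTb
    ((toL2S F K c₀).symm e) g
  rw [← hez, ← hut] at hcomm
  have hStest : S ≤ κ₁ * (Real.sqrt S + Real.sqrt S + CP * Real.sqrt S)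
      * (‖DL2 F n K c₀ U₀ ut‖ + Real.sqrt a * ‖ι (Q'' ut)‖ + ‖ut‖) := by
    have h1 : S = -RCLike.re ⟪e, toL2S F K c₀ (fun x => w x • (toL2S F K c₀).symm (covLapSite F n K c₀ U₀ (toL2S F K c₀ g) + (a : ℂ) • T (ι (Q'' (toL2S F K c₀ g)))) x)
        - (covLapSite F n K c₀ U₀ ut + (a : ℂ) • T (ι (Q'' ut)))⟫_ℂ := by
      rw [hS, hAe, inner_neg_right, map_neg]
    have h2 : S ≤ κ₁ * (‖DL2 F n K c₀ U₀ e‖ + Real.sqrt a * ‖ι (Q'' e)‖ + ‖e‖) * (‖DL2 F n K c₀ U₀ ut‖ + Real.sqrt a * ‖ι (Q'' ut)‖ + ‖ut‖) := by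
      rw [h1]; exact (neg_le_abs _).trans hcomm
    refine h2.trans (mul_le_mul_of_nonneg_right (mul_le_mul_of_nonneg_left (add_le_add (add_le_add hDe hQe) hne) hκ₁0) (by positivity))
  -- sizes of `ũ` from the Agmon rows
  have hrows := agmon_rows_of_massive_eq F h hε₀ hε7 U₀ hreg Q'' hseq ι hι T hT ha w hw wc hwc hρ' hwρ hwρ' hδ₁ hδ hwin g
    (fun x => (w x)⁻¹ • w₀ x) hAu
  have hws : (fun x => w x • ((w x)⁻¹ • w₀ x)) = w₀ := by funext x; rw [smul_smul, mul_inv_cancel₀ (hw0 x), one_smul]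
  rw [hws, ← hMx, ← hCP, ← hut, ← hw0t] at hrows
  have hU1 : ‖ut‖ ≤ 8 * CP ^ 2 * ‖w0t‖ := hrows.1
  have hU2 : ‖DL2 F n K c₀ U₀ ut‖ ≤ 4 * CP * ‖w0t‖ := by
    have h1 : ‖DL2 F n K c₀ U₀ ut‖ ^ 2 ≤ (4 * CP * ‖w0t‖) ^ 2 := le_trans (le_add_of_nonneg_right (by positivity)) hrows.2
    exact (pow_le_pow_iff_left₀ (norm_nonneg _) (by positivity) two_ne_zero).1 h1
  have hU3 : Real.sqrt a * ‖ι (Q'' ut)‖ ≤ 4 * CP * ‖w0t‖ := by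
    have h1 : (Real.sqrt a * ‖ι (Q'' ut)‖) ^ 2 ≤ (4 * CP * ‖w0t‖) ^ 2 := by
      rw [mul_pow, Real.sq_sqrt ha.le]; exact le_trans (le_add_of_nonneg_left (by positivity)) hrows.2
    exact (pow_le_pow_iff_left₀ (by positivity) (by positivity) two_ne_zero).1 h1
  have hXu : ‖DL2 F n K c₀ U₀ ut‖ + Real.sqrt a * ‖ι (Q'' ut)‖ + ‖ut‖ ≤ (8 * CP + 8 * CP ^ 2) * ‖w0t‖ :=
    calc ‖DL2 F n K c₀ U₀ ut‖ + Real.sqrt a * ‖ι (Q'' ut)‖ + ‖ut‖ ≤ 4 * CP * ‖w0t‖ + 4 * CP * ‖w0t‖ + 8 * CP ^ 2 * ‖w0t‖ := add_le_add (add_le_add hU2 hU3) hU1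
      _ = (8 * CP + 8 * CP ^ 2) * ‖w0t‖ := by ring
  -- `√S ≤ κ₁(2 + C_P)X(ũ)`, then `‖e‖ ≤ C_P√S`
  have hsqrtS : Real.sqrt S ≤ κ₁ * (2 + CP) * ((8 * CP + 8 * CP ^ 2) * ‖w0t‖) := by
    have hfac : κ₁ * (Real.sqrt S + Real.sqrt S + CP * Real.sqrt S) * (‖DL2 F n K c₀ U₀ ut‖ + Real.sqrt a * ‖ι (Q'' ut)‖ + ‖ut‖)
        = Real.sqrt S * (κ₁ * (2 + CP) * (‖DL2 F n K c₀ U₀ ut‖ + Real.sqrt a * ‖ι (Q'' ut)‖ + ‖ut‖)) := by ring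
    rw [hfac] at hStest
    have hS' : Real.sqrt S * Real.sqrt S ≤ Real.sqrt S * (κ₁ * (2 + CP) * (‖DL2 F n K c₀ U₀ ut‖ + Real.sqrt a * ‖ι (Q'' ut)‖ + ‖ut‖)) := by
      rw [Real.mul_self_sqrt hS0]; exact hStest
    by_cases h0 : Real.sqrt S = 0
    · rw [h0]; positivity
    · have hpos : 0 < Real.sqrt S := lt_of_le_of_ne (Real.sqrt_nonneg _) (Ne.symm h0)
      have h3 := le_of_mul_le_mul_left hS' hpos
      exact h3.trans (mul_le_mul_of_nonneg_left hXu (by positivity))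
  calc ‖toL2S F K c₀ (fun x => w x • (toL2S F K c₀).symm (G (toL2S F K c₀ (fun x => (w x)⁻¹ • w₀ x))) x) - G (toL2S F K c₀ w₀)‖ = ‖e‖ := by
        rw [he, hut, hg_def, hw0t]
    _ ≤ CP * Real.sqrt S := hne
    _ ≤ CP * (κ₁ * (2 + CP) * ((8 * CP + 8 * CP ^ 2) * ‖w0t‖)) := mul_le_mul_of_nonneg_left hsqrtS hCP0
    _ = CP * (2 + CP) * κ₁ * ((8 * CP + 8 * CP ^ 2) * ‖w0t‖) := by ring

end Resolvent

end Summit.QuantumFields.YangMills.Theorems.Prop7MassiveConjugateResolvent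

end
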